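import Summits.BirchSwinnertonDyer.BirchSwinnertonDyer.Theorems.SignedBaseChangeAnticyclotomicEisensteinDivisibilityAdmdefHowardRigidityRootAllRamified
import Summits.BirchSwinnertonDyer.BirchSwinnertonDyer.Theorems.SignedBaseChangeAnticyclotomicEisensteinDivisibilityAdmdefSignedControlEasy
import Literature.NumberTheory.EllipticCurves.AnticyclotomicSignedLayerZeroControl
import HarnessLib

/-!
# Line `admdef` (crux `AnticyclotomicEisensteinDivisibility`, stmt-BirchSwinnertonDyer-20727), rigidity road: the `±` CONTROL (CTRL) at layer 0
# SUPPLIED BY A NAMED PRINT FACT — Howard's criterion at the root modulo `𝔪` on the all-ramified cell, conditional only on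
# {Hatley–Lei–Vigni 2022 Lemma 3.7 (local form)} + the rank-one bottom line

LEAD seat bsd-line-sbc-p1 (gen 29), `--supports stmt-BirchSwinnertonDyer-20727` (helper; OFF the v23 composition path), acting on director-bsd
ruling (507) «type it yourself … then CTRL enters your assembly as `(hCTRL : <named fact>)`».  The rigidity-road assembly
`…AdmdefHowardRigidityRootAllRamified` (LEAD g28: Howard 2006 Thm. 3.2.3 (c) at the ROOT mod `𝔪` for CHKLL25's signed bipartite systems on the
all-ramified cell) carried ONE non-tree hypothesis,
  (CTRL) `∀ v ∣ p, ∀ X ∈ H¹(K, E[p]), T X ∈ condAboveTorsion (W⁄K) p κ v (sgn ε) 0 1 ⟹ X ∈ selmerLocalKer (W⁄K) K_v p`.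
The Literature file `AnticyclotomicSignedLayerZeroControl.lean` (this seat, gen 29) now types the print statement behind it as the named fact
`AcSigned.hatleyLeiVigni2022_lemma37_local_signedCondition_eq_kummer` — Hatley–Lei–Vigni 2022, proof of Lemma 3.7 (after B.-D. Kim 2007
Prop. 3.16): «`ℋ^±_{0,v}[p^m]` coincides with the image of `E(K_v)/p^m E(K_v)` in `H¹(K_v, A_m)`», i.e. at layer 0 the signed condition
`condAboveTorsion (W⁄K) p κ v (sgn ε) 0 m` EQUALS the classical Kummer condition at the places above `v` (the `v`-component of
`WeierstrassCurve.selmerTorsionOver (κ.layerSubgroup 0) (p^m)`), under `AcSigned.Setting` (p odd, good supersingular, `a_p = 0`, `K` imaginary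
quadratic, `p` split, `κ` anticyclotomic, `p ∤ h_K`) + (Heeg).  THIS FILE:
* §1 `resH1Hom_layerZero_mem_kummer_iff_mem_selmerLocalKer` — the BRIDGE between the two currencies: for `X ∈ H¹(K, E[p])`, `T X` satisfies the
  classical layer-0 condition at the places above `v` IFF `X ∈ selmerLocalKer (W⁄K) K_v p` (same cocycle, same local group; proved).
* §2 `ctrl_of_lemma37_local` — (CTRL) FOLLOWS from the named fact (+ `Setting` + (Heeg)); and `ctrl_iff_of_lemma37_local` (it is an
  equivalence, with LEAD g28's `…AdmdefSignedControlEasy` as the unconditional half).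
* §3 the two assembly theorems of `…AdmdefHowardRigidityRootAllRamified` with `hctrl` DISCHARGED by the named fact:
  `kappa_one_layer_zero_ne_zero_of_isUnit_lam_of_lemma37_local`, `limitBaseClass_layer_zero_one_ne_zero_of_hasUnitLambda_of_lemma37_local` —
  **display: `z_{0,1} ≠ 0` modulo {HLV 2022 Lemma 3.7 (local form), a named print fact} + tree, given `B.HasUnitLambda N` ([NV]), binder (ii)
  «`E[p]` ramified at every `q ∣ N`», `(N, d_K) = 1`, and the rank-one bottom signed Selmer line.**

HONEST FRAMING: theorems only (no definition, no named fact, no `sorry`); the named fact is a HYPOTHESIS `(hloc : AcSigned.hatleyLeiVigni2022_…)`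
(conditional result, trust base = that print statement); nothing about the crux, the anchors (K1) or BSD is asserted; no summit statement is
proved.  Locator hygiene: B.-D. Kim 2007 Prop. 4.18 (height-one control `f_F`) is NOT the statement used; earlier memos of this line mis-cited it.

References: [cite: HatleyLeiVigni2022, Lemma 3.7 (proof), Remark 3.1, Def. 3.4] [cite: BDKim2007, Prop. 3.16] [cite: Howard2006, Thm. 3.2.3 (c)]
[cite: CastellaEtAl2025, Thm. 7.1 (ii), Thm. 7.4, Thm. 7.5 (arXiv:2308.10474v2 pp. 29–31)] [cite: SerreGaloisCohomology1997, I §2.4].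
-/

-- D-0017: single-problem summit, the namespace repeats the problem name by design.
set_option linter.dupNamespace false
set_option autoImplicit false

noncomputable section

open scoped Classical NumberField Pointwise

namespace Summit.BirchSwinnertonDyer.BirchSwinnertonDyer.Theorems.SignedBaseChangeAcDivAdmdefSignedControl

open WeierstrassCurve NumberField IsDedekindDomain Field
open Literature.NumberTheory.EllipticCurves Literature.NumberTheory.GaloisRepresentations
open Literature.NumberTheory.EllipticCurves.CastellaHsuKunduLeeLiu2025
open Literature.NumberTheory.EllipticCurves.BertoliniDarmon2005
open Literature.NumberTheory.EllipticCurves.AcSigned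
open Summit.BirchSwinnertonDyer.BirchSwinnertonDyer.Theorems.AdditiveKoly
open Summit.BirchSwinnertonDyer.BirchSwinnertonDyer.Theorems.SignedBaseChangeAcDivAdmdefCoreRootOfSeenAnchor
open Summit.BirchSwinnertonDyer.BirchSwinnertonDyer.Theorems.SignedBaseChangeAcDivAdmdefRootZero
open Summit.BirchSwinnertonDyer.BirchSwinnertonDyer.Theorems.SignedBaseChangeAcDivAdmdefLayerZeroDictionary
open Summit.BirchSwinnertonDyer.BirchSwinnertonDyer.Theorems.SignedBaseChangeAcDivAdmdefSignedControlEasy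
open Summit.BirchSwinnertonDyer.BirchSwinnertonDyer.Theorems.SignedBaseChangeAcDivAdmdefHowardRigidityRootAllRamified

universe u

/-! ## §1 The bridge between the layer-0 classical condition and `selmerLocalKer` -/

section Bridge

variable {K : Type} [Field K] [NumberField K] (W : WeierstrassCurve ℚ) {p : ℕ} [Fact p.Prime] (κ : ZpExtension K p)

/-- **`T X` satisfies the classical layer-0 condition at the places above `v` IFF `X ∈ selmerLocalKer (W⁄K) K_v p`.**  Here `T = resH1Hom
(Γ_{K_0} ↪ Γ_K, E[(p^1:ℕ)] ↪ E[p^1])` (`…AdmdefLayerZeroDictionary`), the left side is the `v`-component of `WeierstrassCurve.selmerTorsionOver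
(κ.layerSubgroup 0) (p^1)` («every `Γ_K`-conjugate dies in `H¹(Gal(K̄_v/K_v), E(K̄_v))`»; the conjugates are trivial on `H¹(Γ_{K_0}, ·)`,
`Γ_{K_0} = Γ_K`), and both sides say that a cocycle `ψ` of `X` satisfies `ψ(τ|_{K̄}) = τ a − a` on `Γ_{K_v}` for some `a ∈ E(K̄_v)` (the local
group attached to `κ.layerSubgroup 0 = Γ_K` is all of `Γ_{K_v}`). [cite: SerreGaloisCohomology1997, I §2.4] [cite: SerreLocalFields1979, VII.§5 Prop. 3] -/
theorem resH1Hom_layerZero_mem_kummer_iff_mem_selmerLocalKer (v : HeightOneSpectrum (𝓞 K)) (X : Vp W K p) :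
    resH1Hom (Literature.NumberTheory.EllipticCurves.subgroupIncl (κ.layerSubgroup 0))
        (AddSubgroup.inclusion (geomTorsion_natCast_pow_one W (K := K) (p := p)).le) (fun _ _ ↦ rfl) X ∈
      (⨅ σ : absoluteGaloisGroup K,
        (((W.baseChange K).localResTorsionOverOfEmb ((p : ℤ) ^ 1) (κ.layerSubgroup 0)
            (closureEmb (K := K) (v.adicCompletion K))).ker).comap
          (conjH1 (κ.layerSubgroup 0) (geomTorsion (W.baseChange K) ((p : ℤ) ^ 1)) σ)) ↔
      X ∈ selmerLocalKer (W.baseChange K) (v.adicCompletion K) ((p ^ 1 : ℕ) : ℤ) := by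
  -- conjugation by `σ ∈ Γ_K = Γ_{K_0}` is the identity on `H¹(Γ_{K_0}, ·)`
  have hconj : ∀ σ : absoluteGaloisGroup K,
      conjH1 (κ.layerSubgroup 0) (geomTorsion (W.baseChange K) ((p : ℤ) ^ 1)) σ = AddMonoidHom.id _ := fun σ ↦
    Literature.NumberTheory.EllipticCurves.conjH1_of_mem_holds (κ.layerSubgroup 0) (geomTorsion (W.baseChange K) ((p : ℤ) ^ 1))
      (mem_layerSubgroup_zero κ σ)
  have hmem : ∀ τ : absoluteGaloisGroup (v.adicCompletion K),
      τ ∈ localSubgroupOfEmb (κ.layerSubgroup 0) (closureEmb (K := K) (v.adicCompletion K)) := fun τ ↦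
    mem_layerSubgroup_zero κ _
  obtain ⟨ψ, rfl⟩ := oneCocycleClass_surjective
    (discreteTopRep (absoluteGaloisGroup K) (geomTorsion (W.baseChange K) ((p ^ 1 : ℕ) : ℤ))) X
  rw [AddSubgroup.mem_iInf]
  simp only [AddSubgroup.mem_comap, hconj, AddMonoidHom.id_apply, AddMonoidHom.mem_ker]
  rw [resH1Hom_layerZero_oneCocycleClass]
  simp only [WeierstrassCurve.localResTorsionOverOfEmb]
  rw [CocycleCriteria.resH1Hom_oneCocycleClass_eq_zero_iff, selmerLocalKer, oneCocycleClass_mem_resKer_iff]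
  constructor
  · intro h
    obtain ⟨a, ha⟩ := h 1
    exact ⟨a, fun τ ↦ ha ⟨τ, hmem τ⟩⟩
  · rintro ⟨a, ha⟩ _
    exact ⟨a, fun x ↦ ha (x : absoluteGaloisGroup (v.adicCompletion K))⟩

end Bridge

/-! ## §2 (CTRL) from the named fact -/

section Ctrl

variable {K : Type} [Field K] [NumberField K] (W : WeierstrassCurve ℚ) [W.IsGloballyMinimal] {p : ℕ} [Fact p.Prime] (κ : ZpExtension K p)
  {𝔭 𝔭' : HeightOneSpectrum (𝓞 K)}

/-- **(CTRL) holds given Hatley–Lei–Vigni's Lemma 3.7 in local form** (the named fact `AcSigned.hatleyLeiVigni2022_lemma37_local_…`, under the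
`Setting` and (Heeg) for `N_E`): for every `v ∣ p`, every sign and every `X ∈ H¹(K, E[p])`, the layer-0 signed condition on `T X` implies the
Kummer condition on `X` (rewrite the signed condition into the classical one by the fact at `m = 1`, then the bridge of §1).
[cite: HatleyLeiVigni2022, Lemma 3.7 (proof)] [cite: BDKim2007, Prop. 3.16] -/
theorem ctrl_of_lemma37_local (hS : Setting W K p κ 𝔭 𝔭') (hH : SatisfiesHeegnerHypothesis (W.conductorNorm ℤ) K)
    (hloc : hatleyLeiVigni2022_lemma37_local_signedCondition_eq_kummer W K p κ 𝔭 𝔭') (ε : ℤˣ) :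
    ∀ v : HeightOneSpectrum (𝓞 K), ((p : ℕ) : 𝓞 K) ∈ v.asIdeal → ∀ X : Vp W K p,
      resH1Hom (Literature.NumberTheory.EllipticCurves.subgroupIncl (κ.layerSubgroup 0))
          (AddSubgroup.inclusion (geomTorsion_natCast_pow_one W (K := K) (p := p)).le) (fun _ _ ↦ rfl) X ∈
        condAboveTorsion (W.baseChange K) p κ v (.sgn ε) 0 1 →
      X ∈ selmerLocalKer (W.baseChange K) (v.adicCompletion K) ((p ^ 1 : ℕ) : ℤ) := by
  intro v hv X hX
  rw [hloc hS (W.conductorNorm ℤ) rfl hH v hv ε 1] at hX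
  exact (resH1Hom_layerZero_mem_kummer_iff_mem_selmerLocalKer W κ v X).mp hX

/-- **(CTRL) is an equivalence given the named fact**: `T X ∈ condAboveTorsion (W⁄K) p κ v (sgn ε) 0 1 ⟺ X ∈ selmerLocalKer (W⁄K) K_v p` for
`v ∣ p` (the converse is LEAD g28's unconditional `…AdmdefSignedControlEasy.resH1Hom_layerZero_mem_condAboveTorsion_of_mem_selmerLocalKer`).
[cite: HatleyLeiVigni2022, Lemma 3.7 (proof)] -/
theorem ctrl_iff_of_lemma37_local (hS : Setting W K p κ 𝔭 𝔭') (hH : SatisfiesHeegnerHypothesis (W.conductorNorm ℤ) K)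
    (hloc : hatleyLeiVigni2022_lemma37_local_signedCondition_eq_kummer W K p κ 𝔭 𝔭') (ε : ℤˣ)
    {v : HeightOneSpectrum (𝓞 K)} (hv : ((p : ℕ) : 𝓞 K) ∈ v.asIdeal) (X : Vp W K p) :
    resH1Hom (Literature.NumberTheory.EllipticCurves.subgroupIncl (κ.layerSubgroup 0))
        (AddSubgroup.inclusion (geomTorsion_natCast_pow_one W (K := K) (p := p)).le) (fun _ _ ↦ rfl) X ∈
        condAboveTorsion (W.baseChange K) p κ v (.sgn ε) 0 1 ↔
      X ∈ selmerLocalKer (W.baseChange K) (v.adicCompletion K) ((p ^ 1 : ℕ) : ℤ) :=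
  ⟨ctrl_of_lemma37_local W κ hS hH hloc ε v hv X, resH1Hom_layerZero_mem_condAboveTorsion_of_mem_selmerLocalKer W κ v ε X⟩

end Ctrl

/-! ## §3 Howard's criterion at the root mod `𝔪` on the all-ramified cell, (CTRL) discharged by the named fact -/

section Assembly

variable {K : Type} [Field K] [NumberField K] {W : WeierstrassCurve ℚ} [W.IsElliptic] [W.IsGloballyMinimal] {p : ℕ} [Fact p.Prime]
  {κ : ZpExtension K p} {γ : absoluteGaloisGroup K} {N : ℕ} {ε : ℤˣ} {B : SignedBipartiteSystem W K p κ} {𝔭 𝔭' : HeightOneSpectrum (𝓞 K)}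

/-- **Howard's criterion at the root, bottom layer, `κ` form, on the all-ramified cell, modulo HLV Lemma 3.7 (local form)** — unit `λ_1(n₀)(0)`
at some `n₀ ∈ 𝒩_1^def` + the `Setting` + the named fact + `(N, d_K) = 1` + binder (ii) «`E[p]` ramified at every `q ∣ N`» + rank-one bottom signed
Selmer line ⟹ `κ_1(1)_0 ≠ 0`.  (`…AllRamified.kappa_one_layer_zero_ne_zero_of_isUnit_lam_of_allRamified` with `hctrl := ctrl_of_lemma37_local`.)
[cite: Howard2006, Thm. 3.2.3 (c)] [cite: CastellaEtAl2025, Thm. 7.1 (ii), Thm. 7.5 (arXiv:2308.10474v2 pp. 29–31)] [cite: HatleyLeiVigni2022, Lemma 3.7] -/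
theorem kappa_one_layer_zero_ne_zero_of_isUnit_lam_of_lemma37_local (hB : IsSignedBipartiteSystem W K p κ γ N ε B)
    (hS : Setting W K p κ 𝔭 𝔭') (hloc : hatleyLeiVigni2022_lemma37_local_signedCondition_eq_kummer W K p κ 𝔭 𝔭')
    (hN : (N : ℤ) = W.conductorNorm ℤ) (h5 : 5 ≤ p) (hsurj : W.HasSurjectiveModNGaloisRep p)
    (hH : SatisfiesHeegnerHypothesis (W.conductorNorm ℤ) K) (hsp : ((Ideal.span {(p : ℤ)}).primesOver (𝓞 K)).ncard = 2)
    (hND : IsCoprime (N : ℤ) (NumberField.discr K))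
    (hall : ∀ q : ℕ, q.Prime → q ∣ N → ∃ v' : HeightOneSpectrum (𝓞 ℚ), ((q : ℕ) : 𝓞 ℚ) ∈ v'.asIdeal ∧
      ∃ 𝔓 ∈ v'.primesAbove, ∃ σ ∈ 𝔓.inertia (absoluteGaloisGroup ℚ), ∃ P : W.geomTorsion (p : ℤ), σ • P ≠ P)
    {s : (W.baseChange K).torsionH1Over ((p : ℤ) ^ 1) (κ.layerSubgroup 0)}
    (hs : s ∈ signedOrdSelmerTorsion (W.baseChange K) p κ ε 1 0 1) (hs0 : s ≠ 0)
    (hline : ∀ c ∈ signedOrdSelmerTorsion (W.baseChange K) p κ ε 1 0 1, ∃ a : ℤ, c = a • s)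
    {n₀ : ℕ} (hn₀ : n₀ ∈ defProducts N K (fun ℓ ↦ W.frobeniusTrace ℓ) p 1)
    (hlam : IsUnit (PowerSeries.constantCoeff (B.lam 1 n₀))) : B.kappa 1 1 0 ≠ 0 :=
  kappa_one_layer_zero_ne_zero_of_isUnit_lam_of_allRamified hB hN h5 hsurj hS.isImaginaryQuadratic hH hsp hND hS.anticyclotomic
    (ctrl_of_lemma37_local W κ hS hH hloc ε) hall hs hs0 hline hn₀ hlam

/-- **Howard's criterion at the root modulo `𝔪` on the all-ramified cell, in kernel modulo ONE named print fact** — `B.HasUnitLambda N` ([NV]) +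
the `Setting` + {HLV 2022 Lemma 3.7, local form} + `(N, d_K) = 1` + binder (ii) + rank-one bottom signed Selmer line ⟹ `z_{0,1} ≠ 0` for the limit
base class `z` of `B`.  (`…AllRamified.limitBaseClass_layer_zero_one_ne_zero_of_hasUnitLambda_of_allRamified` with `hctrl := ctrl_of_lemma37_local`.)
[cite: Howard2006, Thm. 3.2.3 (c)] [cite: BurungaleCastellaKim2021, arXiv:1908.09512 Prop. 7.4] [cite: CastellaEtAl2025, Thm. 7.1 (ii), Thm. 7.5]
[cite: HatleyLeiVigni2022, Lemma 3.7] -/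
theorem limitBaseClass_layer_zero_one_ne_zero_of_hasUnitLambda_of_lemma37_local (hB : IsSignedBipartiteSystem W K p κ γ N ε B)
    {z : Π n j : ℕ, (W.baseChange K).torsionH1Over ((p : ℤ) ^ j) (κ.layerSubgroup n)} (hz : B.IsLimitBaseClass z)
    (hS : Setting W K p κ 𝔭 𝔭') (hloc : hatleyLeiVigni2022_lemma37_local_signedCondition_eq_kummer W K p κ 𝔭 𝔭')
    (hN : (N : ℤ) = W.conductorNorm ℤ) (h5 : 5 ≤ p) (hsurj : W.HasSurjectiveModNGaloisRep p)
    (hH : SatisfiesHeegnerHypothesis (W.conductorNorm ℤ) K) (hsp : ((Ideal.span {(p : ℤ)}).primesOver (𝓞 K)).ncard = 2)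
    (hND : IsCoprime (N : ℤ) (NumberField.discr K))
    (hall : ∀ q : ℕ, q.Prime → q ∣ N → ∃ v' : HeightOneSpectrum (𝓞 ℚ), ((q : ℕ) : 𝓞 ℚ) ∈ v'.asIdeal ∧
      ∃ 𝔓 ∈ v'.primesAbove, ∃ σ ∈ 𝔓.inertia (absoluteGaloisGroup ℚ), ∃ P : W.geomTorsion (p : ℤ), σ • P ≠ P)
    {s : (W.baseChange K).torsionH1Over ((p : ℤ) ^ 1) (κ.layerSubgroup 0)}
    (hs : s ∈ signedOrdSelmerTorsion (W.baseChange K) p κ ε 1 0 1) (hs0 : s ≠ 0)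
    (hline : ∀ c ∈ signedOrdSelmerTorsion (W.baseChange K) p κ ε 1 0 1, ∃ a : ℤ, c = a • s)
    (hNV : B.HasUnitLambda N) : z 0 1 ≠ 0 :=
  limitBaseClass_layer_zero_one_ne_zero_of_hasUnitLambda_of_allRamified hB hz hN h5 hsurj hS.isImaginaryQuadratic hH hsp hND
    hS.anticyclotomic (ctrl_of_lemma37_local W κ hS hH hloc ε) hall hs hs0 hline hNV

end Assembly

end Summit.BirchSwinnertonDyer.BirchSwinnertonDyer.Theorems.SignedBaseChangeAcDivAdmdefSignedControl

end
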